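import Summits.QuantumFields.BalabanUV.Beta.GAN24.SigmaPairSlotMomentsExit
import Summits.QuantumFields.BalabanUV.Beta.GAN24.SlotChargeProfileEnvelope

/-!
# `BalabanUV.Beta.GAN24.SigmaPairEnvelopeExit` — binder row G-an2-4 ∕ (CONV-C), the (S) row of RULING R-gan24p1-g27-1 PART B (viii), the σ-pair's exit⊗exit profile:
# **THE `hZ` ENVELOPE — `∃ B δ > 0, |Z_k(y′)| ≤ B·e^{−δ‖y′ − y‖₁}` AT EVERY LEVEL `k`, ANY IN-BLOCK ROOT, ALL `cE cVH cΛ`, in the product-weight currency of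
# `SigmaPairSlotMomentsExit` and in the transported currency of `SigmaPairTransportedMomentsExit`** — so that, together with (M0) ∧ (Π) of those files, ALL THREE displayed
# sockets `hZ ∕ hM0 ∕ hP1` of leaf-01's (LT-3) `LayerPushMoments.abs_tsum_mul_le_of_moments` are theorems for the σ-pair piece at level 0
# (G-an2-4 formalisation swarm → CRUX TEAM (2), seat `b2b-balaban-gan24-formalise-leaf-02`, gen 59, INTENT 5)

NOT IN PRINT; OUR BOOKKEEPING ([folklore] instantiation BY NAME: leaf-01 g65 `SlotChargeProfileEnvelope.abs_slotProfile_le` (the (α)-shape envelope for ANY kernel given through its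
column envelopes) with `abs_weightedCharge_le_of_locStencil ∕ _of_vertexFamily`, an2's `abs_colH_le ∕ abs_colM_le` on `decays_coDressKBmAt_KInvStep k`, `locStencil_SpureRecAt k`,
`vertexFamily_M1At k`; leaf-06 g45 `GaugeReadChargeComb.exists_envelope_comb_gaugeCharge` (the (γ) envelope, level-generic); 0 `def`, 0 cited fact, 0 `def … : Prop`, 0 sorry).
HONEST FRAMING (cell contract, verbatim): «discharging `BetaPertH` makes Bałaban's UV stability UNCONDITIONAL — a real constructive-QFT result; it is NOT the continuum limit and NOT
the Clay problem.»  HONEST DEPENDENCY (verbatim): «continuum YM on T⁴ ⇐ BetaPertH ∧ nine spine estimates (0/9 proved); BetaPertH ⇐ (D1) ∧ (D4) ∧ CAP+tail; G-an2-4 gates asym, D1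
and NE2/3/4.»
* §1 **`exists_envelope_baseProfile_exit_level`** — the BASE-POINT (α) profile `Vα_k` at the exit⊗exit weight is exponentially localised at the label (existential constants, per `k`).
* §2 **`exists_envelope_sigmaPair_exit_level`** — hence `Z_k = Vα_k − ½·(stepScale_k·Lc^{d+1})⁻¹·Q^{comb}_k` is (`|a − c·b| ≤ |a| + |c|·|b|`, the smaller rate);
  **`exists_envelope_transported_sigmaPair_exit_level`** — and so is `−Lc²σ_k²·Z_k`.
READING.  No `j`-uniformity claimed (constants existential per level, as in leaf-01's `exists_transportedProfile_envelope` — the (α)-piece alone at `j+1`, ∧-weights); asserts NO value of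
Bałaban's tables; NOTHING of (W-γ) ∕ (Q-R) ∕ (DL) ∕ (LT) ∕ «T2Shape» ∕ (hW, hWall); NEVER «G-an2-4 closed» as (CONV-C); NOT D1, NOT `BetaPertH`, NOT continuum, NOT Clay.  2026-08-22.
-/

noncomputable section

open Finset
open scoped BigOperators
open Literature.MathematicalPhysics.QuantumFieldTheory
open Literature.MathematicalPhysics.QuantumFieldTheory.Balaban1983to89
open Literature.MathematicalPhysics.QuantumFieldTheory.Balaban1983to89.Beta
open B12Sec2to5 (l1 l1_nonneg)
open ExpKernelCalculus (Site MKer comp Zl Zl_nonneg)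
open AffineAveraging (box toSite)
open AveragingContours (blk)
open OneStepResolventKernel (Fib)
open OneStepKernelFamily (KInvStep colH abs_colH_le)
open SecondOrderResponse (colM dM abs_colM_le)
open Summit.QuantumFields.BalabanUV.Beta.BorderedHessian (stepScale)
open Summit.QuantumFields.BalabanUV.Beta.AxialDressingRooted (coDressKBmAt decays_coDressKBmAt_KInvStep)
open Summit.QuantumFields.BalabanUV.Beta.SpineRooted (SpureRecAt M1At locStencil_SpureRecAt vertexFamily_M1At)
open Summit.QuantumFields.BalabanUV.Beta.KernelWardRelative (gaugeWt)
open Summit.QuantumFields.BalabanUV.Beta.GAN24.SlotChargeProfileEnvelope (abs_slotProfile_le abs_weightedCharge_le_of_locStencil abs_weightedCharge_le_of_vertexFamily)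
open Summit.QuantumFields.BalabanUV.Beta.GAN24.GaugeReadChargeComb (exists_envelope_comb_gaugeCharge)
open Summit.QuantumFields.BalabanUV.Beta.GAN24.SigmaPairSlotMomentsExit (abs_exitWt_le_one)

namespace Summit.QuantumFields.BalabanUV.Beta.GAN24.SigmaPairEnvelopeExit

variable {d Lc : ℕ} [NeZero Lc]

/-- [folklore] Two envelopes combine: `|a| ≤ B₁e^{−δ₁ℓ}`, `|b| ≤ B₂e^{−δ₂ℓ}`, `ℓ ≥ 0`, `B₁, B₂ ≥ 0` ⇒ `|a − c·b| ≤ (B₁ + |c|·B₂)·e^{−min(δ₁,δ₂)·ℓ}`. -/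
theorem abs_sub_mul_le_envelope {a b c B₁ B₂ δ₁ δ₂ ℓ : ℝ} (hℓ : 0 ≤ ℓ) (hB₁ : 0 ≤ B₁) (hB₂ : 0 ≤ B₂)
    (ha : |a| ≤ B₁ * Real.exp (-δ₁ * ℓ)) (hb : |b| ≤ B₂ * Real.exp (-δ₂ * ℓ)) :
    |a - c * b| ≤ (B₁ + |c| * B₂) * Real.exp (-(min δ₁ δ₂) * ℓ) := by
  have e1 : Real.exp (-δ₁ * ℓ) ≤ Real.exp (-(min δ₁ δ₂) * ℓ) := Real.exp_le_exp.2 (by nlinarith [min_le_left δ₁ δ₂])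
  have e2 : Real.exp (-δ₂ * ℓ) ≤ Real.exp (-(min δ₁ δ₂) * ℓ) := Real.exp_le_exp.2 (by nlinarith [min_le_right δ₁ δ₂])
  calc |a - c * b| ≤ |a| + |c * b| := abs_sub _ _
    _ = |a| + |c| * |b| := by rw [abs_mul]
    _ ≤ B₁ * Real.exp (-δ₁ * ℓ) + |c| * (B₂ * Real.exp (-δ₂ * ℓ)) := add_le_add ha (mul_le_mul_of_nonneg_left hb (abs_nonneg c))
    _ ≤ B₁ * Real.exp (-(min δ₁ δ₂) * ℓ) + |c| * (B₂ * Real.exp (-(min δ₁ δ₂) * ℓ)) :=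
        add_le_add (mul_le_mul_of_nonneg_left e1 hB₁) (mul_le_mul_of_nonneg_left (mul_le_mul_of_nonneg_left e2 hB₂) (abs_nonneg c))
    _ = (B₁ + |c| * B₂) * Real.exp (-(min δ₁ δ₂) * ℓ) := by ring

/-- [folklore] An envelope constant is nonnegative (read at the centre). -/
theorem envelope_nonneg {Z : Site (d + 1) → ℝ} {y : Site (d + 1)} {B δ : ℝ} (h : ∀ e, |Z e| ≤ B * Real.exp (-δ * l1 (e - y))) : 0 ≤ B := by
  have h0 := h y
  rw [sub_self, show l1 (0 : Site (d + 1)) = 0 by simp [l1], mul_zero, Real.exp_zero, mul_one] at h0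
  exact (abs_nonneg _).trans h0

/-! ## §1 The (α) base-point profile is exponentially localised at the label -/

/-- NOT IN PRINT; OUR BOOKKEEPING.  **THE `hZ` ENVELOPE OF THE (α) BASE-POINT PROFILE AT THE exit⊗exit WEIGHT, EVERY LEVEL** (any in-block root `ρ = toSite r`, all `cE cVH cΛ`,
every `k y ν α β`): `∃ B δ, 0 < δ ∧ ∀ y′, |Vα_k(y′)| ≤ B·e^{−δ‖y′ − y‖₁}` — leaf-01 g65's `abs_slotProfile_le` at `K′ = G_k` (an2's column envelopes of the decaying comb), charges bounded by
`abs_weightedCharge_le_of_locStencil ∕ _of_vertexFamily` (`|ω| ≤ 1`). -/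
theorem exists_envelope_baseProfile_exit_level (hLc : 1 ≤ Lc) {r : Fin (d + 1) → ℕ} (hr : r ∈ box (d + 1) Lc) (cE cVH cΛ : ℝ) (k : ℕ)
    (y : Site (d + 1)) (ν α β : Fin (d + 1)) :
    ∃ B δ : ℝ, 0 < δ ∧ ∀ y' : Site (d + 1),
      |(1 / 2 : ℝ) *
        ((∑ κ : Fin (d + 1), ∑' u : Site (d + 1),
            colH (coDressKBmAt (toSite r) Lc (KInvStep (d := d) Lc k)) Lc ν y' κ u
              * ((if y' = y then (1 / 2 : ℝ) else 0) - (if blk Lc u = y then (1 / 2 : ℝ) else 0))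
              * ∑' xz : Site (d + 1) × Site (d + 1),
                  ((if xz.1 α % (Lc : ℤ) = (Lc : ℤ) - 1 then (1 : ℝ) else 0) * (if xz.2 β % (Lc : ℤ) = (Lc : ℤ) - 1 then (1 : ℝ) else 0))
                    * SpureRecAt d Lc (toSite r) cE cVH cΛ k κ u xz.1 xz.2 (Sum.inl α) (Sum.inl β))
          + ∑ ρ' : Fin (d + 1), ∑' w : Site (d + 1),
            colM (coDressKBmAt (toSite r) Lc (KInvStep (d := d) Lc k)) Lc ν y' ρ' w
              * ((if y' = y then (1 / 2 : ℝ) else 0) - (if w = y then (1 / 2 : ℝ) else 0))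
              * ∑' xz : Site (d + 1) × Site (d + 1),
                  ((if xz.1 α % (Lc : ℤ) = (Lc : ℤ) - 1 then (1 : ℝ) else 0) * (if xz.2 β % (Lc : ℤ) = (Lc : ℤ) - 1 then (1 : ℝ) else 0))
                    * M1At d Lc (toSite r) cΛ k ρ' w xz.1 xz.2 (Sum.inl α) (Sum.inl β))| ≤ B * Real.exp (-δ * l1 (y' - y)) := by
  obtain ⟨δG, CG, hδG, hCG, hG⟩ := decays_coDressKBmAt_KInvStep (d := d) hr k
  obtain ⟨Cs, δs, hδs, hS⟩ := locStencil_SpureRecAt (d := d) (Lc := Lc) hLc hr cE cVH cΛ k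
  have hM := vertexFamily_M1At (d := d) hLc hr cΛ k (le_of_lt one_pos)
  have hω := abs_exitWt_le_one (Lc := Lc) (d := d) α β
  have hzS := fun κ u => abs_weightedCharge_le_of_locStencil hS hδs hω κ u (Sum.inl α) (Sum.inl β)
  have hzM := fun ρ' w => abs_weightedCharge_le_of_vertexFamily hM one_pos hω ρ' w (Sum.inl α) (Sum.inl β)
  have hCs := (abs_nonneg _).trans (hzS 0 0)
  have hCM := (abs_nonneg _).trans (hzM 0 0)
  exact ⟨_, δG / 2, half_pos hδG, fun y' =>
    abs_slotProfile_le (K' := coDressKBmAt (toSite r) Lc (KInvStep (d := d) Lc k)) hLc hδG hCG hCs hCM ν y y'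
      (fun κ u => abs_colH_le (N := Lc) hG ν y' κ u) (fun ρ w => abs_colM_le (N := Lc) hG ν y' ρ w) hzS hzM⟩

/-! ## §2 The σ-pair's profile, both currencies -/

/-- NOT IN PRINT; OUR BOOKKEEPING.  **THE `hZ` ENVELOPE OF THE σ-PAIR's exit⊗exit PROFILE `Z_k = Vα_k − ½·cH_k·Q^{comb}_k`, EVERY LEVEL** (any in-block root, all `cE cVH cΛ`, every
`k y ν α β`): `∃ B δ, 0 < δ ∧ ∀ y′, |Z_k(y′)| ≤ B·e^{−δ‖y′ − y‖₁}` — §1 + leaf-06 g45 `exists_envelope_comb_gaugeCharge`.  With `SigmaPairSlotMomentsExit` §3∕§4 this is the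
complete hypothesis triple `hZ ∕ hM0 ∕ hP1` of the (LT-3) consumer for this piece (level 0: no displayed hypothesis beyond the pin for `α ≠ β`). -/
theorem exists_envelope_sigmaPair_exit_level (hLc : 1 ≤ Lc) {r : Fin (d + 1) → ℕ} (hr : r ∈ box (d + 1) Lc) (cE cVH cΛ : ℝ) (k : ℕ)
    (y : Site (d + 1)) (ν α β : Fin (d + 1)) :
    ∃ B δ : ℝ, 0 < δ ∧ ∀ y' : Site (d + 1),
      |(1 / 2 : ℝ) *
        ((∑ κ : Fin (d + 1), ∑' u : Site (d + 1),
            colH (coDressKBmAt (toSite r) Lc (KInvStep (d := d) Lc k)) Lc ν y' κ u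
              * ((if y' = y then (1 / 2 : ℝ) else 0) - (if blk Lc u = y then (1 / 2 : ℝ) else 0))
              * ∑' xz : Site (d + 1) × Site (d + 1),
                  ((if xz.1 α % (Lc : ℤ) = (Lc : ℤ) - 1 then (1 : ℝ) else 0) * (if xz.2 β % (Lc : ℤ) = (Lc : ℤ) - 1 then (1 : ℝ) else 0))
                    * SpureRecAt d Lc (toSite r) cE cVH cΛ k κ u xz.1 xz.2 (Sum.inl α) (Sum.inl β))
          + ∑ ρ' : Fin (d + 1), ∑' w : Site (d + 1),
            colM (coDressKBmAt (toSite r) Lc (KInvStep (d := d) Lc k)) Lc ν y' ρ' w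
              * ((if y' = y then (1 / 2 : ℝ) else 0) - (if w = y then (1 / 2 : ℝ) else 0))
              * ∑' xz : Site (d + 1) × Site (d + 1),
                  ((if xz.1 α % (Lc : ℤ) = (Lc : ℤ) - 1 then (1 : ℝ) else 0) * (if xz.2 β % (Lc : ℤ) = (Lc : ℤ) - 1 then (1 : ℝ) else 0))
                    * M1At d Lc (toSite r) cΛ k ρ' w xz.1 xz.2 (Sum.inl α) (Sum.inl β))
        - (1 / 2 : ℝ) * (stepScale d Lc k * (Lc : ℝ) ^ (d + 1))⁻¹ *
          (∑ κ : Fin (d + 1), ∑' u : Site (d + 1),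
              (∑' x₂, ∑ κ₂, comp (coDressKBmAt (toSite r) Lc (KInvStep (d := d) Lc k))
                  (dM (coDressKBmAt (toSite r) Lc (KInvStep (d := d) Lc k)) Lc (SpureRecAt d Lc (toSite r) cE cVH cΛ k) (M1At d Lc (toSite r) cΛ k) ν y')
                  u x₂ (Sum.inl κ) (Sum.inl κ₂) * gaugeWt Lc y κ₂ x₂)
                * ∑' xz : Site (d + 1) × Site (d + 1),
                    ((if xz.1 α % (Lc : ℤ) = (Lc : ℤ) - 1 then (1 : ℝ) else 0) * (if xz.2 β % (Lc : ℤ) = (Lc : ℤ) - 1 then (1 : ℝ) else 0))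
                      * SpureRecAt d Lc (toSite r) cE cVH cΛ k κ u xz.1 xz.2 (Sum.inl α) (Sum.inl β)
            + ∑ ρ' : Fin (d + 1), ∑' w : Site (d + 1),
              (∑' x₂, ∑ κ₂, comp (coDressKBmAt (toSite r) Lc (KInvStep (d := d) Lc k))
                  (dM (coDressKBmAt (toSite r) Lc (KInvStep (d := d) Lc k)) Lc (SpureRecAt d Lc (toSite r) cE cVH cΛ k) (M1At d Lc (toSite r) cΛ k) ν y')
                  ((Lc : ℤ) • w) x₂ (Sum.inr ρ') (Sum.inl κ₂) * gaugeWt Lc y κ₂ x₂)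
                * ∑' xz : Site (d + 1) × Site (d + 1),
                    ((if xz.1 α % (Lc : ℤ) = (Lc : ℤ) - 1 then (1 : ℝ) else 0) * (if xz.2 β % (Lc : ℤ) = (Lc : ℤ) - 1 then (1 : ℝ) else 0))
                      * M1At d Lc (toSite r) cΛ k ρ' w xz.1 xz.2 (Sum.inl α) (Sum.inl β))| ≤ B * Real.exp (-δ * l1 (y' - y)) := by
  obtain ⟨B₁, δ₁, hδ₁, h₁⟩ := exists_envelope_baseProfile_exit_level hLc hr cE cVH cΛ k y ν α β
  obtain ⟨B', δ', hδ', hb⟩ := exists_envelope_comb_gaugeCharge (d := d) hLc hr cE cVH cΛ k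
  have hω := abs_exitWt_le_one (Lc := Lc) (d := d) α β
  have h₂ : ∀ y', _ ≤ (B' * 1) * Real.exp (-δ' * l1 (y' - y)) := fun y' => by
    have h := hb y ν (Sum.inl α) (Sum.inl β) _ 1 hω y'
    exact h
  have hB₁ := envelope_nonneg h₁
  have hB₂ := envelope_nonneg h₂
  exact ⟨B₁ + |(1 / 2 : ℝ) * (stepScale d Lc k * (Lc : ℝ) ^ (d + 1))⁻¹| * (B' * 1), min δ₁ δ', lt_min hδ₁ hδ', fun y' =>
    abs_sub_mul_le_envelope (l1_nonneg _) hB₁ hB₂ (h₁ y') (h₂ y')⟩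

/-- NOT IN PRINT; OUR BOOKKEEPING.  **THE `hZ` ENVELOPE IN THE TRANSPORTED CURRENCY**: the profile `−Lc²σ_k²·Z_k` (the value of
`SigmaPairTransportedMomentsExit.hasSum_transported_sigmaPair_exit_level`) obeys the same kind of bound. -/
theorem exists_envelope_transported_sigmaPair_exit_level (hLc : 1 ≤ Lc) {r : Fin (d + 1) → ℕ} (hr : r ∈ box (d + 1) Lc) (cE cVH cΛ : ℝ) (k : ℕ)
    (y : Site (d + 1)) (ν α β : Fin (d + 1)) :
    ∃ B δ : ℝ, 0 < δ ∧ ∀ y' : Site (d + 1),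
      |-((Lc : ℝ) ^ 2 * (((((Lc ^ (k + 1) : ℕ) : ℝ)) ^ (d + 1 + 1))⁻¹) ^ 2) *
        ((1 / 2 : ℝ) *
          ((∑ κ : Fin (d + 1), ∑' u : Site (d + 1),
              colH (coDressKBmAt (toSite r) Lc (KInvStep (d := d) Lc k)) Lc ν y' κ u
                * ((if y' = y then (1 / 2 : ℝ) else 0) - (if blk Lc u = y then (1 / 2 : ℝ) else 0))
                * ∑' xz : Site (d + 1) × Site (d + 1),
                    ((if xz.1 α % (Lc : ℤ) = (Lc : ℤ) - 1 then (1 : ℝ) else 0) * (if xz.2 β % (Lc : ℤ) = (Lc : ℤ) - 1 then (1 : ℝ) else 0))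
                      * SpureRecAt d Lc (toSite r) cE cVH cΛ k κ u xz.1 xz.2 (Sum.inl α) (Sum.inl β))
            + ∑ ρ' : Fin (d + 1), ∑' w : Site (d + 1),
              colM (coDressKBmAt (toSite r) Lc (KInvStep (d := d) Lc k)) Lc ν y' ρ' w
                * ((if y' = y then (1 / 2 : ℝ) else 0) - (if w = y then (1 / 2 : ℝ) else 0))
                * ∑' xz : Site (d + 1) × Site (d + 1),
                    ((if xz.1 α % (Lc : ℤ) = (Lc : ℤ) - 1 then (1 : ℝ) else 0) * (if xz.2 β % (Lc : ℤ) = (Lc : ℤ) - 1 then (1 : ℝ) else 0))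
                      * M1At d Lc (toSite r) cΛ k ρ' w xz.1 xz.2 (Sum.inl α) (Sum.inl β))
          - (1 / 2 : ℝ) * (stepScale d Lc k * (Lc : ℝ) ^ (d + 1))⁻¹ *
            (∑ κ : Fin (d + 1), ∑' u : Site (d + 1),
                (∑' x₂, ∑ κ₂, comp (coDressKBmAt (toSite r) Lc (KInvStep (d := d) Lc k))
                    (dM (coDressKBmAt (toSite r) Lc (KInvStep (d := d) Lc k)) Lc (SpureRecAt d Lc (toSite r) cE cVH cΛ k) (M1At d Lc (toSite r) cΛ k) ν y')
                    u x₂ (Sum.inl κ) (Sum.inl κ₂) * gaugeWt Lc y κ₂ x₂)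
                  * ∑' xz : Site (d + 1) × Site (d + 1),
                      ((if xz.1 α % (Lc : ℤ) = (Lc : ℤ) - 1 then (1 : ℝ) else 0) * (if xz.2 β % (Lc : ℤ) = (Lc : ℤ) - 1 then (1 : ℝ) else 0))
                        * SpureRecAt d Lc (toSite r) cE cVH cΛ k κ u xz.1 xz.2 (Sum.inl α) (Sum.inl β)
              + ∑ ρ' : Fin (d + 1), ∑' w : Site (d + 1),
                (∑' x₂, ∑ κ₂, comp (coDressKBmAt (toSite r) Lc (KInvStep (d := d) Lc k))
                    (dM (coDressKBmAt (toSite r) Lc (KInvStep (d := d) Lc k)) Lc (SpureRecAt d Lc (toSite r) cE cVH cΛ k) (M1At d Lc (toSite r) cΛ k) ν y')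
                    ((Lc : ℤ) • w) x₂ (Sum.inr ρ') (Sum.inl κ₂) * gaugeWt Lc y κ₂ x₂)
                  * ∑' xz : Site (d + 1) × Site (d + 1),
                      ((if xz.1 α % (Lc : ℤ) = (Lc : ℤ) - 1 then (1 : ℝ) else 0) * (if xz.2 β % (Lc : ℤ) = (Lc : ℤ) - 1 then (1 : ℝ) else 0))
                        * M1At d Lc (toSite r) cΛ k ρ' w xz.1 xz.2 (Sum.inl α) (Sum.inl β)))| ≤ B * Real.exp (-δ * l1 (y' - y)) := by
  obtain ⟨B, δ, hδ, h⟩ := exists_envelope_sigmaPair_exit_level hLc hr cE cVH cΛ k y ν α β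
  refine ⟨|-((Lc : ℝ) ^ 2 * (((((Lc ^ (k + 1) : ℕ) : ℝ)) ^ (d + 1 + 1))⁻¹) ^ 2)| * B, δ, hδ, fun y' => ?_⟩
  rw [abs_mul]
  calc _ ≤ |-((Lc : ℝ) ^ 2 * (((((Lc ^ (k + 1) : ℕ) : ℝ)) ^ (d + 1 + 1))⁻¹) ^ 2)| * (B * Real.exp (-δ * l1 (y' - y))) := mul_le_mul_of_nonneg_left (h y') (abs_nonneg _)
    _ = _ := by ring

end Summit.QuantumFields.BalabanUV.Beta.GAN24.SigmaPairEnvelopeExit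

end
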